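import Summits.ValiantsHypothesis.ValiantsHypothesis.Theorems.LacunarySymmetroidMatrixDescartesCensusDenseRows

/-!
# `MatrixDescartes` census — SHARP ROWS ARE DECIDED OFF ANY PROPER ALGEBRAIC HYPERSURFACE OF THE LETTER SPACE

HONEST FRAMING.  Object-search cell `pub-symmetroid`, door-A seat `val-sym-door-p3` (g17); items stmt-ValiantsHypothesis-19980
`DoorA34 = PosRootLawAt 3 4 18` and stmt-ValiantsHypothesis-19979 `DoorA26 = PosRootLawAt 2 6 19` are OPEN and asserted nowhere
in this file.  Nothing here bounds `ζ_sym`; nothing bears on `MatrixDescartes` (stmt-ValiantsHypothesis-18050) or on `VP ≠ VNP`.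

CONTENT (every format `(m, K)`, every sharp bound `B`; no `def`, no `sorry`).  `…CensusDenseRows` shows that a sharp row is decided on
any family of letter tuples that is dense among the symmetric tuples.  This file supplies the generic such family: the complement of the
zero set of ANY polynomial `Φ` in the matrix entries that does not vanish at some symmetric tuple.
* **`exists_symm_near_eval_ne_zero`** — if `Φ(S₀) ≠ 0` for one symmetric tuple `S₀`, then every neighbourhood of every symmetric tuple
  contains a symmetric tuple `S'` with `Φ(S') ≠ 0` (substitute `x_{l,i,j} + x_{l,j,i}` for the entry variables — `MvPolynomial.bind₁` —,
  so that the restriction of `Φ` to the symmetric tuples is a polynomial in free coordinates, non-zero by hypothesis; a non-zero real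
  polynomial does not vanish identically on a box with infinite sides, `MvPolynomial.funext_set`);
* **`posRootLawAt_iff_rows_off_hypersurface`** — hence `PosRootLawAt m K B` (sharp `B`) holds iff the row `≤ B` holds for the symmetric
  tuples OFF the hypersurface `{Φ = 0}`; `doorA34_iff_rows_off_hypersurface`, `doorA26_iff_rows_off_hypersurface`.
USE.  The remaining kernel gap of the chart programme (`…CensusDoorA34EqualDiagonalChart{,Rows}`, `…CensusDoorA34HollowCornerChart`) is now
ONE implication with no topology in it: a polynomial `Φ ≢ 0` on symmetric tuples such that `Φ(S) ≠ 0` forces the annihilator pencil of the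
net `span{S_l}` to be really split or to carry a real line pair with non-isotropic vertex (the discriminant of the pencil's binary cubic
times a rank minor does it on paper; NOT proved here).
[folklore] Identity theorem for polynomials on a box; elementary topology.
-/

-- `Summit.ValiantsHypothesis.ValiantsHypothesis.…` repeats a component by the D-0017 layout
-- (single-conjunct summit), which the `dupNamespace` linter flags; the name is mandated.
set_option linter.dupNamespace false

namespace Summit.ValiantsHypothesis.ValiantsHypothesis.Theorems.LacunarySymmetroidMatrixDescartes.Census.DenseRows

open Finset Filter Topology Polynomial
open scoped BigOperators Matrix
open Summit.ValiantsHypothesis.ValiantsHypothesis.Theorems.MatrixDescartes.Negative (PosRootLawAt)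

variable {m K : ℕ}

/-- **Symmetric tuples off a hypersurface are dense among symmetric tuples.**  Let `Φ` be a real polynomial in the entry variables
`x_{l,i,j}` (`l : Fin K`, `i j : Fin m`) with `Φ(S₀) ≠ 0` for some SYMMETRIC tuple `S₀`.  Then every open set containing a symmetric tuple
`S` contains a symmetric tuple `S'` with `Φ(S') ≠ 0`. [folklore] -/
theorem exists_symm_near_eval_ne_zero (Φ : MvPolynomial (Fin K × Fin m × Fin m) ℝ)
    (hΦ : ∃ S₀ : Fin K → Matrix (Fin m) (Fin m) ℝ, (∀ l, (S₀ l).IsSymm) ∧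
      MvPolynomial.eval (fun idx : Fin K × Fin m × Fin m => S₀ idx.1 idx.2.1 idx.2.2) Φ ≠ 0)
    (S : Fin K → Matrix (Fin m) (Fin m) ℝ) (hS : ∀ l, (S l).IsSymm)
    (U : Set (Fin K → Matrix (Fin m) (Fin m) ℝ)) (hU : IsOpen U) (hSU : S ∈ U) :
    ∃ S' ∈ U, (∀ l, (S' l).IsSymm) ∧
      MvPolynomial.eval (fun idx : Fin K × Fin m × Fin m => S' idx.1 idx.2.1 idx.2.2) Φ ≠ 0 := by
  classical
  -- free coordinates of the symmetric tuples: `mk x = (x_{l,i,j} + x_{l,j,i})`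
  set mk : (Fin K × Fin m × Fin m → ℝ) → (Fin K → Matrix (Fin m) (Fin m) ℝ) :=
    fun x l => Matrix.of fun i j => x (l, i, j) + x (l, j, i) with hmk
  have hmk_symm : ∀ x l, (mk x l).IsSymm := fun x l => by
    refine Matrix.IsSymm.ext fun i j => ?_
    simp only [hmk, Matrix.of_apply]; ring
  have hmk_cont : Continuous mk := by
    refine continuous_pi fun l => continuous_matrix fun i j => ?_
    exact ((continuous_apply _).add (continuous_apply _))
  have hmk_half : ∀ T : Fin K → Matrix (Fin m) (Fin m) ℝ, (∀ l, (T l).IsSymm) →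
      mk (fun idx => T idx.1 idx.2.1 idx.2.2 / 2) = T := fun T hT => by
    funext l; ext i j
    simp only [hmk, Matrix.of_apply]
    rw [(hT l).apply j i]; ring
  -- the restriction of `Φ` to symmetric tuples, as a polynomial in the free coordinates
  set τ : Fin K × Fin m × Fin m → MvPolynomial (Fin K × Fin m × Fin m) ℝ :=
    fun idx => MvPolynomial.X idx + MvPolynomial.X (idx.1, idx.2.2, idx.2.1) with hτ
  set Ψ := MvPolynomial.bind₁ τ Φ with hΨ
  have hΨeval : ∀ x, MvPolynomial.eval x Ψ
      = MvPolynomial.eval (fun idx : Fin K × Fin m × Fin m => mk x idx.1 idx.2.1 idx.2.2) Φ := by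
    intro x
    have hfun : (fun i => MvPolynomial.eval₂Hom (RingHom.id ℝ) x (τ i)) = fun idx => mk x idx.1 idx.2.1 idx.2.2 := by
      funext idx
      simp [hτ, hmk]
    rw [hΨ, MvPolynomial.eval, MvPolynomial.eval₂Hom_bind₁, hfun, MvPolynomial.eval]
  have hΨne : Ψ ≠ 0 := by
    obtain ⟨S₀, hS₀, hΦ0⟩ := hΦ
    intro h0
    apply hΦ0
    have := hΨeval (fun idx => S₀ idx.1 idx.2.1 idx.2.2 / 2)
    rw [hmk_half S₀ hS₀, h0, map_zero] at this
    exact this.symm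
  -- an open box of free coordinates inside `mk ⁻¹' U`
  set x₁ : Fin K × Fin m × Fin m → ℝ := fun idx => S idx.1 idx.2.1 idx.2.2 / 2 with hx₁
  have hx₁U : x₁ ∈ mk ⁻¹' U := by
    show mk x₁ ∈ U; rw [hx₁, hmk_half S hS]; exact hSU
  obtain ⟨r, hr, hball⟩ := Metric.isOpen_iff.mp (hU.preimage hmk_cont) x₁ hx₁U
  have hbox : ¬ ∀ x ∈ Set.pi Set.univ (fun idx : Fin K × Fin m × Fin m => Set.Ioo (x₁ idx - r) (x₁ idx + r)),
      MvPolynomial.eval x Ψ = MvPolynomial.eval x 0 := by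
    intro h
    exact hΨne (MvPolynomial.funext_set _ (fun idx => Set.Ioo_infinite (by linarith)) h)
  push Not at hbox
  obtain ⟨x, hx, hxΨ⟩ := hbox
  rw [map_zero] at hxΨ
  have hxball : x ∈ Metric.ball x₁ r := by
    rw [ball_pi _ hr, Set.mem_pi]
    intro idx _
    rw [Real.ball_eq_Ioo]
    exact hx idx (Set.mem_univ _)
  refine ⟨mk x, hball hxball, hmk_symm x, ?_⟩
  rw [← hΨeval]; exact hxΨ

/-- **A SHARP ROW IS DECIDED OFF ANY PROPER ALGEBRAIC HYPERSURFACE.**  For a sharp bound `B` and any polynomial `Φ` in the matrix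
entries not vanishing at some symmetric tuple, `PosRootLawAt m K B` holds iff every symmetric tuple `S` with `Φ(S) ≠ 0` has `≤ B` distinct
positive det-roots on every support. [folklore] -/
theorem posRootLawAt_iff_rows_off_hypersurface {B : ℕ}
    (hB : (univ.filter (fun lam : Fin m → Fin K => Monotone lam)).card ≤ B + 2)
    (Φ : MvPolynomial (Fin K × Fin m × Fin m) ℝ)
    (hΦ : ∃ S₀ : Fin K → Matrix (Fin m) (Fin m) ℝ, (∀ l, (S₀ l).IsSymm) ∧
      MvPolynomial.eval (fun idx : Fin K × Fin m × Fin m => S₀ idx.1 idx.2.1 idx.2.2) Φ ≠ 0) :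
    PosRootLawAt m K B ↔ ∀ (d : Fin K → ℕ) (S : Fin K → Matrix (Fin m) (Fin m) ℝ), (∀ l, (S l).IsSymm) →
      MvPolynomial.eval (fun idx : Fin K × Fin m × Fin m => S idx.1 idx.2.1 idx.2.2) Φ ≠ 0 →
        ((∑ l, (X : ℝ[X]) ^ d l • (S l).map C).det.roots.toFinset.filter (fun x => 0 < x)).card ≤ B := by
  constructor
  · intro h d S hS _
    exact h d S hS
  · intro h
    refine posRootLawAt_of_denseRows hB
      {S | MvPolynomial.eval (fun idx : Fin K × Fin m × Fin m => S idx.1 idx.2.1 idx.2.2) Φ ≠ 0} ?_ ?_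
    · intro S hS U hU hSU
      obtain ⟨S', hS'U, hS'symm, hS'Φ⟩ := exists_symm_near_eval_ne_zero Φ hΦ S hS U hU hSU
      exact ⟨S', hS'Φ, hS'symm, hS'U⟩
    · intro d S hSΦ hS
      exact h d S hS hSΦ

/-- **`DoorA34` off a hypersurface**: for any polynomial `Φ` in the `36` entry variables of a four-letter `3 × 3` tuple with `Φ(S₀) ≠ 0` at
some symmetric `S₀`, `DoorA34` (`Iff.rfl`-equal to the route item `Theses.LacunarySymmetroid.DoorA34`, stmt-ValiantsHypothesis-19980) holds
iff every symmetric tuple off `{Φ = 0}` has `≤ 18` distinct positive det-roots on every support. [folklore] -/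
theorem doorA34_iff_rows_off_hypersurface (Φ : MvPolynomial (Fin 4 × Fin 3 × Fin 3) ℝ)
    (hΦ : ∃ S₀ : Fin 4 → Matrix (Fin 3) (Fin 3) ℝ, (∀ l, (S₀ l).IsSymm) ∧
      MvPolynomial.eval (fun idx : Fin 4 × Fin 3 × Fin 3 => S₀ idx.1 idx.2.1 idx.2.2) Φ ≠ 0) :
    DoorA34 ↔ ∀ (d : Fin 4 → ℕ) (S : Fin 4 → Matrix (Fin 3) (Fin 3) ℝ), (∀ l, (S l).IsSymm) →
      MvPolynomial.eval (fun idx : Fin 4 × Fin 3 × Fin 3 => S idx.1 idx.2.1 idx.2.2) Φ ≠ 0 →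
        ((∑ l, (X : ℝ[X]) ^ d l • (S l).map C).det.roots.toFinset.filter (fun x => 0 < x)).card ≤ 18 :=
  posRootLawAt_iff_rows_off_hypersurface (by decide) Φ hΦ

/-- **`DoorA26` off a hypersurface** (stmt-ValiantsHypothesis-19979; `24` entry variables of a six-letter `2 × 2` tuple). [folklore] -/
theorem doorA26_iff_rows_off_hypersurface (Φ : MvPolynomial (Fin 6 × Fin 2 × Fin 2) ℝ)
    (hΦ : ∃ S₀ : Fin 6 → Matrix (Fin 2) (Fin 2) ℝ, (∀ l, (S₀ l).IsSymm) ∧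
      MvPolynomial.eval (fun idx : Fin 6 × Fin 2 × Fin 2 => S₀ idx.1 idx.2.1 idx.2.2) Φ ≠ 0) :
    DoorA26 ↔ ∀ (d : Fin 6 → ℕ) (S : Fin 6 → Matrix (Fin 2) (Fin 2) ℝ), (∀ l, (S l).IsSymm) →
      MvPolynomial.eval (fun idx : Fin 6 × Fin 2 × Fin 2 => S idx.1 idx.2.1 idx.2.2) Φ ≠ 0 →
        ((∑ l, (X : ℝ[X]) ^ d l • (S l).map C).det.roots.toFinset.filter (fun x => 0 < x)).card ≤ 19 :=
  posRootLawAt_iff_rows_off_hypersurface (by decide) Φ hΦ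

end Summit.ValiantsHypothesis.ValiantsHypothesis.Theorems.LacunarySymmetroidMatrixDescartes.Census.DenseRows
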